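import Mathlib

/-!
# Kelvin-mode decay: the critical-layer lifetime is `∝ P^{-2/3}` (solo-blind kernel #189)

Paper `steady-zeroth-law.md` §24.106 (3)–(4) / PLAN §107.  Near the critical layer `θ = π/2` of the Doppler profile `2h cos θ` the deleted leaf chain is, in the
angle variable, the linear-shear advection–diffusion model `∂_t u = K ∂_η² u - i β η u` (`β = 2P|h|`, `K = K₀`).  Along Fourier characteristics (Kelvin modes) the
amplitude of the mode started at wavenumber `ξ` is multiplied by `exp(-K Φ(ξ, t))` with the phase integral

  `Φ(ξ, t) = ∫₀ᵗ (ξ + β τ)² dτ = ξ² t + ξ β t² + β² t³/3`,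

and the content of the "layer lifetime `(12/(K β²))^{1/3} ∝ P^{-2/3}`" statement is the uniform lower bound `Φ(ξ, t) ≥ β² t³/12` (minimum at `ξ = -β t/2`), i.e. every
Kelvin mode has decayed by `exp(-K β² t³/12)` after time `t`, whatever its initial wavenumber.

* `kelvinPhase_eq` — evaluation of the phase integral;
* `kelvinPhase_lower` — `β² t³/12 ≤ ξ² t + ξ β t² + β² t³/3` for `t ≥ 0` (all real `ξ, β`);
* `kelvinMode_decay` — `exp(-K Φ) ≤ exp(-K β² t³/12)` for `K, t ≥ 0`.
-/

namespace Summit.AnomalousDissipation.AnomalousDissipation.Theorems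

open Real intervalIntegral

/-- The Kelvin phase integral `∫₀ᵗ (ξ + β τ)² dτ = ξ² t + ξ β t² + β² t³ / 3`. -/
theorem kelvinPhase_eq (ξ β t : ℝ) :
    ∫ τ in (0:ℝ)..t, (ξ + β * τ) ^ 2 = ξ ^ 2 * t + ξ * β * t ^ 2 + β ^ 2 * t ^ 3 / 3 := by
  have h : ∀ τ : ℝ, (ξ + β * τ) ^ 2 = ξ ^ 2 + 2 * ξ * β * τ + β ^ 2 * τ ^ 2 := fun τ => by ring
  simp_rw [h]
  rw [integral_add, integral_add, integral_const, integral_const_mul, integral_const_mul, integral_id, integral_pow]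
  · simp; ring
  · exact (continuous_const).intervalIntegrable _ _
  · exact (continuous_const.mul continuous_id).intervalIntegrable _ _
  · exact (continuous_const.add (continuous_const.mul continuous_id)).intervalIntegrable _ _
  · exact (continuous_const.mul (continuous_id.pow 2)).intervalIntegrable _ _

/-- Uniform lower bound of the Kelvin phase: `β² t³ / 12 ≤ ξ² t + ξ β t² + β² t³ / 3` for `t ≥ 0` (equality at `ξ = -β t / 2`). -/
theorem kelvinPhase_lower (ξ β t : ℝ) (ht : 0 ≤ t) :
    β ^ 2 * t ^ 3 / 12 ≤ ξ ^ 2 * t + ξ * β * t ^ 2 + β ^ 2 * t ^ 3 / 3 := by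
  have key : ξ ^ 2 * t + ξ * β * t ^ 2 + β ^ 2 * t ^ 3 / 3 - β ^ 2 * t ^ 3 / 12 = t * (ξ + β * t / 2) ^ 2 := by ring
  nlinarith [mul_nonneg ht (sq_nonneg (ξ + β * t / 2))]

/-- The case of equality: the mode with `ξ = -β t/2` attains the bound. -/
theorem kelvinPhase_lower_sharp (β t : ℝ) :
    (-(β * t / 2)) ^ 2 * t + (-(β * t / 2)) * β * t ^ 2 + β ^ 2 * t ^ 3 / 3 = β ^ 2 * t ^ 3 / 12 := by ring

/-- **Kelvin-mode decay.** Every mode has decayed by `exp(-K β² t³/12)` after time `t`: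
`exp(-K ∫₀ᵗ(ξ+βτ)²dτ) ≤ exp(-K β² t³ / 12)` for `K, t ≥ 0`; hence the layer lifetime `(12/(K β²))^{1/3}`, `∝ P^{-2/3}` for `β ∝ P`. -/
theorem kelvinMode_decay (K ξ β t : ℝ) (hK : 0 ≤ K) (ht : 0 ≤ t) :
    exp (-K * ∫ τ in (0:ℝ)..t, (ξ + β * τ) ^ 2) ≤ exp (-K * (β ^ 2 * t ^ 3 / 12)) := by
  rw [kelvinPhase_eq, exp_le_exp]
  have := kelvinPhase_lower ξ β t ht
  nlinarith

end Summit.AnomalousDissipation.AnomalousDissipation.Theorems
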